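import Summits.CriticalPhenomena.PercolationContinuityZ3.Theorems.PercNearOneGluingNoHeavyLowerTailKnQuestion8CoefficientwiseInGadgetCex
import Mathlib.Data.Fin.VecNotation
import HarnessLib

/-!
# The principal-event off-cluster conjecture PEOC (prim-lf-2 gen 60) is FALSE — a kernel-checked 7-vertex witness

Support file (`--supports stmt-CriticalPhenomena-4575`, closed), prover `prim-lf-2` (gen 63).  No named facts, no sorries; standard axioms; the arithmetic is
`decide +kernel` on the two-colour edge recursion `IGCex.cwRec` of `…CoefficientwiseInGadgetCex.lean` (`2¹⁰` leaves).  Memo `prim-lf-2/CW-NCA-gen63.md` §9.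

Setting: uniform two-colourings `s` (red edge set) of a finite multigraph, `K s` the red cluster of the root `0`, `K(E∖s)` the blue one, `T = (f(K s) − f(K(E∖s)))(g(K s) − g(K(E∖s)))`
for monotone `f, g`.  CONJECTURE PEOC (prim-lf-2 gen 60, memo CW-ATOM-gen60 §8; census-clean on all graphs with ≤ 6 vertices): for every vertex set `W₀`,
`Σ_{s : W₀ ⊆ K(E∖s)} T ≥ 0` ('Harris restricted to a blue-connection event'; `W₀ = {v}` is the atom sum `A₀B + A_KB` = (I4) of the NC-SPLIT table).
IT FAILS on 7 vertices: `G` with edges `01 02 04 05 06 13 15 16 23 24`, root `0`, `W₀ = {3}`, `f = pt 4`, `g = pt 5 · pt 6` (the indicator of `{5,6} ⊆ ·`):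
the restricted sum is `−2` (aligned mass 160, crossed mass 162 among the 573 colourings with `3` in the blue cluster).
* `Coefficientwise.PEOCCex.peoc_sum_eq` — `Σ_{s ⊆ E : 3 ∈ K(E∖s)} (pt 4 (K s) − pt 4 (K(E∖s)))·(pp (K s) − pp (K(E∖s))) = −2`, `pp A = pt 5 A · pt 6 A`;
* `Coefficientwise.PEOCCex.not_peoc_point` — hence "for every vertex `v` and all monotone `f, g`, `Σ_{s : v ∈ K(E∖s)} T ≥ 0`" is false for this graph.
By the colour swap the same sum is `Σ_{s : 3 ∈ K s} T` ('`v ∈ K`'), so the increasing-literal family and the 'unified conjecture U' of gen 63 are false as well; the NCA / NC*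
family (NO-CORE with two-sided avoidance; `…CoefficientwiseNCAGlue.lean`) is NOT affected (census-clean on this graph and on all graphs with ≤ 7 vertices and ≤ 11 edges).
[cite: KozmaNitzan2024, Questions 8–9 (§5.5 p. 36) (context: the Question-8 pocket covariance programme)]
-/

namespace Summit.CriticalPhenomena.PercolationContinuityZ3.Theorems

open Finset Literature.Probability.Percolation Literature.Computation.FiniteGraph

namespace Coefficientwise

namespace PEOCCex

open IGCex

/-- Edge table of the witness (7 vertices, 10 edges). -/
def EL₅ : Fin 10 → ℕ × ℕ := ![(0,1), (0,2), (0,4), (0,5), (0,6), (1,3), (1,5), (1,6), (2,3), (2,4)]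

/-- All entries of `EL₅` are vertices of `Fin 7`. -/
theorem hEL₅ : ∀ i, (EL₅ i).1 < 7 ∧ (EL₅ i).2 < 7 := by decide

/-- The 7-vertex graph of the witness. -/
def ends₅ : Fin 10 → Sym2 (Fin 7) := endsOf EL₅ hEL₅

/-- All ten edges as a list (for the recursion). -/
def lE₅ : List (Fin 10) := [0, 1, 2, 3, 4, 5, 6, 7, 8, 9]

/-- The red cluster of the root `0` as a function of the red edge set. -/
noncomputable def K₅ (s : Finset (Fin 10)) : Set (Fin 7) := openCluster (ends₅ '' (↑s : Set (Fin 10))) 0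

/-- The monotone pair-indicator `pp A = pt 5 A · pt 6 A = 1[{5,6} ⊆ A]`. -/
noncomputable def pp (A : Set (Fin 7)) : ℝ := pt 5 A * pt 6 A

/-- Point functions are nonnegative. [folklore] -/
theorem pt_nonneg {m : ℕ} (v : Fin m) (A : Set (Fin m)) : 0 ≤ pt v A := by
  unfold pt; split_ifs
  · exact zero_le_one
  · exact le_rfl

/-- `pp` is monotone. [folklore] -/
theorem pp_monotone : Monotone pp := fun A B hAB =>
  mul_le_mul (pt_monotone 5 hAB) (pt_monotone 6 hAB) (pt_nonneg 6 A) (pt_nonneg 5 B)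

/-- `pp` evaluated through Boolean tests. [folklore] -/
theorem pp_eq_of_iff {A : Set (Fin 7)} {p q : Bool} (hp : (5 : Fin 7) ∈ A ↔ p = true) (hq : (6 : Fin 7) ∈ A ↔ q = true) :
    pp A = if (p && q) then 1 else 0 := by
  rw [pp, pt_eq_of_iff hp, pt_eq_of_iff hq]
  cases p <;> cases q <;> simp

/-- Integer leaf of the restricted sum: `[3 ∈ blue cluster]·(r₄ − b₄)(r₅r₆ − b₅b₆)`. -/
def leaf₅ (lr lb : List ℕ) : ℤ :=
  leafB (jl lb 0 3) (jl lr 0 4) (jl lb 0 4) (jl lr 0 5 && jl lr 0 6) (jl lb 0 5 && jl lb 0 6)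

/-- Kernel evaluation: the PEOC recursion of the witness is `−2`. -/
theorem cwRec₅ : cwRec leaf₅ (lE₅.map EL₅) (List.range 7) (List.range 7) = -2 := by
  decide +kernel

open Classical in
/-- Real leaf of the restricted sum as a function of the red and blue edge sets. -/
noncomputable def LEAF₅ (R B : Finset (Fin 10)) : ℝ :=
  (if (3 : Fin 7) ∈ openCluster (ends₅ '' (↑B : Set (Fin 10))) 0 then (1 : ℝ) else 0) *
    ((pt 4 (openCluster (ends₅ '' (↑R : Set (Fin 10))) 0) - pt 4 (openCluster (ends₅ '' (↑B : Set (Fin 10))) 0)) *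
      (pp (openCluster (ends₅ '' (↑R : Set (Fin 10))) 0) - pp (openCluster (ends₅ '' (↑B : Set (Fin 10))) 0)))

open Classical in
/-- The integer leaf computes the real leaf of the witness. -/
theorem HL₅ : ∀ (R B : Finset (Fin 10)) (labR labB : List ℕ),
    (∃ op : List (ℕ × ℕ), cfgOf 7 op = endsOf EL₅ hEL₅ '' (↑R : Set (Fin 10)) ∧ LabelsOK 7 op labR) →
    (∃ op : List (ℕ × ℕ), cfgOf 7 op = endsOf EL₅ hEL₅ '' (↑B : Set (Fin 10)) ∧ LabelsOK 7 op labB) →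
    (leaf₅ labR labB : ℝ) = LEAF₅ R B := by
  intro R B labR labB hR hB
  rw [leaf₅, leafB_cast, LEAF₅, ends₅, ite_eq_of_iff (mem_iff_of_inv hB 0 3), pt_eq_of_iff (mem_iff_of_inv hR 0 4), pt_eq_of_iff (mem_iff_of_inv hB 0 4),
    pp_eq_of_iff (mem_iff_of_inv hR 0 5) (mem_iff_of_inv hR 0 6), pp_eq_of_iff (mem_iff_of_inv hB 0 5) (mem_iff_of_inv hB 0 6)]
  rfl

open Classical in
/-- **The PEOC sum of the witness is `−2`**: over the colourings `s` with `3` in the BLUE cluster `K₅ (E ∖ s)` (`E` = all ten edges),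
`Σ (pt 4 (K s) − pt 4 (K(E∖s)))·(pp (K s) − pp (K(E∖s))) = −2`. -/
theorem peoc_sum_eq :
    (∑ s ∈ (univ : Finset (Fin 10)).powerset.filter (fun s : Finset (Fin 10) => (3 : Fin 7) ∈ K₅ (univ \ s)),
      (pt 4 (K₅ s) - pt 4 (K₅ (univ \ s))) * (pp (K₅ s) - pp (K₅ (univ \ s)))) = -2 := by
  have hbridge := cwRec_eq_sum EL₅ hEL₅ leaf₅ LEAF₅ HL₅ lE₅ (by decide) ∅ ∅ _ _ (inv_empty EL₅ hEL₅) (inv_empty EL₅ hEL₅)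
  have hl : lE₅.toFinset = (univ : Finset (Fin 10)) := by decide
  rw [hl, cwRec₅] at hbridge
  rw [Finset.sum_filter]
  have hsum : ∀ s ∈ (univ : Finset (Fin 10)).powerset,
      (if (3 : Fin 7) ∈ K₅ (univ \ s) then (pt 4 (K₅ s) - pt 4 (K₅ (univ \ s))) * (pp (K₅ s) - pp (K₅ (univ \ s))) else 0) =
        LEAF₅ (∅ ∪ s) (∅ ∪ (univ \ s)) := by
    intro s _
    by_cases hc : (3 : Fin 7) ∈ K₅ (univ \ s)
    · rw [if_pos hc]
      simp only [K₅] at hc ⊢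
      simp only [Finset.empty_union, LEAF₅, if_pos hc, one_mul]
    · rw [if_neg hc]
      simp only [K₅] at hc ⊢
      simp only [Finset.empty_union, LEAF₅, if_neg hc, zero_mul]
  rw [Finset.sum_congr rfl hsum, ← hbridge]
  norm_num

open Classical in
/-- **PEOC is false**: it is not the case that for every vertex `v` and all monotone `f, g` the two-colouring sum restricted to `{v ∈ blue cluster of the root}` is nonnegative
(witness: `v = 3`, `f = pt 4`, `g = pp`, sum `−2`). -/
theorem not_peoc_point :
    ¬ (∀ (v : Fin 7) (f g : Set (Fin 7) → ℝ), Monotone f → Monotone g →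
      0 ≤ ∑ s ∈ (univ : Finset (Fin 10)).powerset.filter (fun s : Finset (Fin 10) => v ∈ K₅ (univ \ s)),
        (f (K₅ s) - f (K₅ (univ \ s))) * (g (K₅ s) - g (K₅ (univ \ s)))) := by
  intro h
  have h0 := h 3 (pt 4) pp (pt_monotone 4) pp_monotone
  rw [peoc_sum_eq] at h0
  linarith

end PEOCCex

end Coefficientwise

end Summit.CriticalPhenomena.PercolationContinuityZ3.Theorems
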